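import Mathlib
import Summits.PneNP.PneNP.Theorems.SymmetryBudgetHamCompilesFWiresSpan

/-!
# Wire values of the F-side DAG, part 2: the obligation `stub_symmetricF_wires`
# (stub `stub_symmetricF`; line `kotzig-cutspan`, crux `SymmetryBudget.HamCompiles`,
# stmt-PneNP-10637)

Continuation of `SymmetryBudgetHamCompilesFWiresSpan.lean`. Under the explicit semantics `fsem`
of `SymmetryBudgetHamCompilesFDagSem.lean`, the composite WIRES of the F-side DAG (`uW`, `oTab`,
`cTab`, `accW`, `leftW`, `tabW`, `rowW`, `zW` of `SymmetryBudgetHamCompilesFDag.lean`, all defined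
by `if`s on indices and pointing at gates) carry their intended values — the dictionary every
gate-by-gate proof of the sibling obligations needs:

* clause 3 (`wsem_accW`): the accumulator wires carry the tables of the inner accumulators
  (the `out` gates of the last block of the previous inner chain, `CH_inner_N`);
* clauses 1–2 (`wsem_oTab`, `wsem_cTab`): the table wires of the open / closed states carry the
  reduced echelon tables of `Ospan` / `Cspan` (`TS_ot`, `TS_ct`, `rrefRow_span_one`);
* clauses 4–7 (`wsem_leftW`, `wsem_tabW`, `wsem_rowW`, `wsem_zW`): left tables, block tables,
  row sources and partial remainders, by unfolding the wiring against the semantics.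

Together with the span identities of part 1 this is `stub_symmetricF_wires : SymF.WireVals m x`,
the registered obligation 1/5 of `stub_symmetricF`. Auxiliary lemmas live in `SymF.Wires`.
-/

-- `Summit.PneNP.PneNP.…` duplicates `PneNP` BY DESIGN (single-problem summit, D-0017).
set_option linter.dupNamespace false

noncomputable section

namespace Summit.PneNP.PneNP.Theorems.HamCompilesKC

open Literature.Computability.Complexity
open Finset

namespace SymF

namespace Wires

variable {m : ℕ} (x : Fin m × Fin m → Bool)

/-! ### Scalars and elementary wires -/

/-- `tb 0 = false`. -/
theorem tb_zero : tb 0 = false := by decide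

/-- `tb 1 = true`. -/
theorem tb_one : tb 1 = true := by decide

/-- `tb` of a guarded scalar. -/
theorem tb_ite (p : Prop) [Decidable p] (a : ZMod 2) :
    tb (if p then a else 0) = (decide p && tb a) := by
  by_cases hp : p <;> simp [hp, tb_zero]

/-- Wires of F-side gates evaluate by `gsem`. -/
theorem wsem_fW (f : FG m) : wsem m x (fW f) = gsem m x f := rfl

/-- The zero wire is `false`. -/
theorem wsem_zeroW : wsem m x (zeroW : FW m) = false := rfl

/-- `kLast + 1 = N`. -/
theorem kLast_succ (m : ℕ) : ((kLast m : Fin (N m)) : ℕ) + 1 = N m := by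
  show N m - 1 + 1 = N m
  have := N_pos m
  omega

/-! ### The accumulator wires (clause 3) -/

/-- **Clause 3: the accumulator wires carry the tables of the inner accumulators.** -/
theorem wsem_accW (P : PSet m) (e : Cd m) (t : Fin m) (r : ℕ) (c c' : K m)
    (hr : r ≤ gOf m * gOf m) :
    wsem m x (accW P e t r c c') = tb (rrefRow (IS m x P e t r) c c') := by
  unfold accW
  by_cases h0 : r = 0
  · subst h0
    rw [if_pos rfl, IS_zero, rrefRow_bot, Pi.zero_apply, tb_zero]
    rfl
  · have h1 : r - 1 < gOf m * gOf m := by omega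
    rw [if_neg h0, dif_pos h1]
    show tb (rrefRow (CH m x (.inner P e t ⟨r - 1, h1⟩) ((kLast m : ℕ) + 1)) c c') = _
    rw [kLast_succ, CH_inner_N]
    show tb (rrefRow (IS m x P e t (r - 1 + 1)) c c') = _
    rw [Nat.sub_add_cancel (Nat.one_le_iff_ne_zero.2 h0)]

/-! ### Table, row and remainder wires (clauses 1, 2, 4–7) -/

/-- Table wires of tower nodes carry the table of the tower partial sum. -/
theorem wsem_uW (τ : TCtx m) (B : PSet m) (c c' : K m) :
    wsem m x (uW τ B c c') = tb (rrefRow (TS m x τ B) c c') := by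
  cases τ with
  | ot P t i e =>
    simp only [uW]
    by_cases hB : B.1 = ∅
    · rw [if_pos hB, TS_empty x _ B hB]
      rfl
    · rw [if_neg hB, wsem_fW]
      simp only [gsem]
      rw [if_neg hB]
  | ct P e =>
    simp only [uW]
    by_cases hB : B.1 = ∅
    · rw [if_pos hB, TS_empty x _ B hB, baseSub_ct, rrefRow_bot, Pi.zero_apply, tb_zero]
      rfl
    · rw [if_neg hB, wsem_fW]
      simp only [gsem]
      rw [if_neg hB]

/-- **Clause 1: the open-state table wires.** -/
theorem wsem_oTab (P : PSet m) (t : Fin m) (i : Fin (gOf m)) (e : Cd m) (c c' : K m) :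
    wsem m x (oTab P t i e c c') = tb (rrefRow (OS m x P t i e) c c') := by
  unfold oTab
  by_cases ht : t ∈ P.1
  · rw [if_pos ht, wsem_uW, TS_ot x ht]
  · rw [if_neg ht, OS_of_not_mem x ht, rrefRow_bot, Pi.zero_apply, tb_zero]
    rfl

/-- **Clause 2: the closed-state table wires.** -/
theorem wsem_cTab (P : PSet m) (e : Cd m) (c c' : K m) :
    wsem m x (cTab P e c c') = tb (rrefRow (CS m x P e) c c') := by
  unfold cTab
  by_cases hP : P.1 = ∅
  · rw [if_pos hP, wsem_fW]
    simp only [gsem]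
    unfold CS
    rw [hP, Cspan_empty]
    by_cases h0 : dOf e = 0
    · rw [if_pos h0, rrefRow_span_one, tb_ite, tb_one, Bool.and_true]
      unfold cmin
      simp [h0]
    · rw [if_neg h0, rrefRow_bot, Pi.zero_apply, tb_zero]
      simp [h0]
  · rw [if_neg hP, wsem_uW, TS_ct x (Finset.nonempty_iff_ne_empty.2 hP)]

/-- **Clause 4: the left table wires of the chains.** -/
theorem wsem_leftW (χ : ChCtx m) (c c' : K m) :
    wsem m x (leftW χ c c') = tb (rrefRow (leftSub m x χ) c c') := by
  rcases χ with ⟨τ, B, w⟩ | ⟨P, e, t, r⟩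
  · simp only [leftW, leftSub]
    by_cases hw : w ∈ B.1
    · rw [if_pos hw, if_pos hw, wsem_uW]
    · rw [if_neg hw, if_neg hw, rrefRow_bot, Pi.zero_apply, tb_zero]
      rfl
  · exact wsem_accW x P e t r c c' r.2.le

/-- **Clause 5: the table wires read by the blocks.** -/
theorem wsem_tabW (χ : ChCtx m) (k : Fin (N m)) (c c' : K m) :
    wsem m x (tabW χ k c c') = tb (tabSem m x χ k c c') := by
  unfold tabW tabSem
  by_cases hk : (k : ℕ) = 0
  · rw [if_pos hk, wsem_leftW, hk, CH_zero]
  · rw [if_neg hk]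
    show tb (rrefRow (CH m x χ ((k : ℕ) - 1 + 1)) c c') = _
    rw [Nat.sub_add_cancel (Nat.one_le_iff_ne_zero.2 hk)]

/-- **Clause 6: the row-source wires.** -/
theorem wsem_rowW (χ : ChCtx m) (k : Fin (N m)) (c' : K m) :
    wsem m x (rowW χ k c') = tb (yvec m x χ k c') := by
  rcases χ with ⟨τ, B, w⟩ | ⟨P, e, t, r⟩
  · rcases τ with ⟨P, t, i, e⟩ | ⟨P, e⟩
    · simp only [rowW, yvec, wsem_fW, gsem]
      by_cases hp : (Gr m x).Adj w t ∧ t ∈ P.1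
      · rw [if_pos hp]
        simp [hp]
      · rw [if_neg hp, Pi.zero_apply, tb_zero]
        simp [hp]
    · simp only [rowW, yvec, innerTab]
      exact wsem_accW x P e w _ (kc k) c' le_rfl
  · simp only [rowW, yvec]
    by_cases hc : c' (pr r).1 = c' (pr r).2 ∧ MGuard e (pr r).1 (pr r).2
    · rw [if_pos hc, wsem_fW]
      simp only [gsem]
      by_cases hr : rk m x t = ((pr r).2 : ℕ)
      · rw [if_pos ⟨hc.1, hc.2, hr⟩]
        simp [hr]
      · rw [if_neg fun h => hr h.2.2, tb_zero]
        simp [hr]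
    · rw [if_neg hc, if_neg fun h => hc ⟨h.1, h.2.1⟩, wsem_zeroW, tb_zero]

/-- `z^{(0)} = y`. -/
theorem zs_zero (χ : ChCtx m) (k : Fin (N m)) : zs m x χ k 0 = yvec m x χ k := by
  simp [zs]

/-- **Clause 7: the partial-remainder wires.** -/
theorem wsem_zW (χ : ChCtx m) (k : Fin (N m)) (s : ℕ) (c' : K m) (hs : s ≤ N m) :
    wsem m x (zW χ k s c') = tb (zs m x χ k s c') := by
  unfold zW
  by_cases h0 : s = 0
  · subst h0
    rw [if_pos rfl, wsem_rowW, zs_zero]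
  · have h1 : s - 1 < N m := by omega
    rw [if_neg h0, dif_pos h1]
    show tb (zs m x χ k (s - 1 + 1) c') = _
    rw [Nat.sub_add_cancel (Nat.one_le_iff_ne_zero.2 h0)]

end Wires

end SymF

/-- **Obligation `stub_symmetricF_wires` of stub `stub_symmetricF`** (line `kotzig-cutspan`):
under the explicit semantics `fsem`, the table wires of the states carry the reduced echelon
tables of `Ospan` / `Cspan`, the accumulator / left / table / row / remainder wires carry their
intended vectors, the vectors inserted by a chain span exactly its term, and every chain ends at
`left ⊔ term`. -/
theorem stub_symmetricF_wires (m : ℕ) (x : Fin m × Fin m → Bool) : SymF.WireVals m x := by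
  unfold SymF.WireVals
  exact ⟨SymF.Wires.wsem_oTab x, SymF.Wires.wsem_cTab x,
    fun P e t r c c' hr => SymF.Wires.wsem_accW x P e t r c c' hr, SymF.Wires.wsem_leftW x,
    SymF.Wires.wsem_tabW x, SymF.Wires.wsem_rowW x,
    fun χ k s c' hs => SymF.Wires.wsem_zW x χ k s c' hs, SymF.Wires.span_yvec x,
    SymF.Wires.CH_N_eq x⟩

end Summit.PneNP.PneNP.Theorems.HamCompilesKC
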